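import Literature.AlgebraicGeometry.Frobenioids.ArchimedeanIsotropicAnchors
import Literature.AlgebraicGeometry.Frobenioids.ArchimedeanIsometrizationFunctors
import HarnessLib

/-!
# Frobenioids II, Proposition 3.5 (iv) «`C` is not of RC-iso-subanchor type» — PROVED for
# `C = C₀ ×_{D₀} D` under Example 3.3's standing hypotheses on `D` (connected, totally epimorphic)

Mochizuki, *The geometry of Frobenioids II*, Kyushu J. Math. **62** (2008) 401–460, §3, Prop. 3.5 (iv),
kurims text p. 34 [cite: MochizukiFrdII2008, Prop 3.5 (iv) p.34]: "`F` is not of RC-iso-subanchor type";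
proof pp. 35–36: "Suppose that `F` is of RC-iso-subanchor type. Then … `F` admits a complex isotropic
object `A`. Since `A` is an RC-iso-subanchor, it follows immediately, by taking isotropic hulls [cf. the
argument of [FrdI], Remark 3.1.1], that `F` admits a complex isotropic RC-subanchor `B`, hence [cf.
[FrdI], Definition 1.3, (vii), (b)] that `F` admits a complex isotropic RC-anchor `C`", which is absurd.

Contents (all PROVED, directly from the explicit structure of Ex. 3.3 (i); no appeal to the unproved
`ArchFrd.Ex33ii_isFrobenioid` — contrast abc-iut-w4-d027's `ArchimedeanNotIsoSubanchor.lean`, which proves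
the generic statement for every FROBENIOID and hence `Prop35iv_C` conditionally on `IsFrobenioid (C.toElem π)`):
* the **[FrdI] Rmk. 3.1.1 argument** for `C`: a mono-minimal categorical quotient `B → X` by
  `G ⊆ Aut(B)` with `X` (naively) isotropic has `B` (naively) isotropic — `B → X` factors through the hull
  `B → B^istr` (`toIstr`, a monomorphism on which `G` acts compatibly via the isotropification functor
  `istrEndo`, `istrAutHom`), so mono-minimality makes the hull an isomorphism
  (`isNaivelyIsotropic_of_monoMinimalQuotient`);
* **Prop. 3.5 (iv) for `C = C^ℤ`**: `prop35iv_C : IsGraphConnected D → IsTotallyEpimorphic D → Prop35iv_C π`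
  — the instance `Prop35iv_C` of `ArchimedeanTheoremsInstances.lean` under the two standing hypotheses of
  Example 3.3 on `D` ("`D` is any connected, totally epimorphic category", kurims p. 28), which the
  instance does not carry (finding P35iv-F1: at `D = ∅` the instance is false — both RC-iso-subanchor-type
  structures are vacuous). The hypothesis "`D` of RC-iso-subanchor type" of Prop. 3.5 is not needed for (iv).

No statement of the paper is strengthened; nothing here bears on [IUTchIII].
-/

namespace Literature.AlgebraicGeometry.Frobenioids

open CategoryTheory
open scoped Pointwise

noncomputable section

universe v u

namespace ArchFrd

variable {D : Type u} [Category.{v} D] (π : D ⥤ D0)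

/-! ### The isotropic hull `B → B^istr` (`toIstr`, `ArchimedeanIsometrizationFunctors.lean`): monomorphism,
universal property towards isotropic objects, compatibility with automorphisms -/

/-- The components of a composite with the hull arrow `B → B^istr`. [cite: MochizukiFrdII2008, Ex 3.3 (ii) p.28] -/
theorem comp_toIstr_fst {Z B : C π} (f : Z ⟶ B) :
    C0.Base (f ≫ toIstr π B).fst = C0.Base f.fst ∧ C0.degFr (f ≫ toIstr π B).fst = C0.degFr f.fst ∧
      C0.scalar (f ≫ toIstr π B).fst = C0.scalar f.fst := by
  refine ⟨?_, ?_, ?_⟩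
  · change C0.Base f.fst ≫ 𝟙 _ = _; exact Category.comp_id _
  · change C0.degFr f.fst * 1 = _; exact mul_one _
  · rw [CFP.comp_fst, C0.scalar_comp']
    change D0.galAct (D0.Hom.twists (C0.Base f.fst)) 1 * C0.scalar f.fst ^ ((1 : ℕ+) : ℕ) = _
    rw [map_one, one_mul, PNat.one_coe, pow_one]

/-- The hull arrow is a monomorphism (its components are identities and `1`). [cite: MochizukiFrdI2008, Def. 1.3(v)] -/
theorem mono_toIstr (B : C π) : Mono (toIstr π B) := by
  refine ⟨fun {Z} f g h => ?_⟩
  obtain ⟨hb₁, hd₁, hs₁⟩ := comp_toIstr_fst π f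
  obtain ⟨hb₂, hd₂, hs₂⟩ := comp_toIstr_fst π g
  have hsnd : f.snd = g.snd := by
    have e : (f ≫ toIstr π B).snd = (g ≫ toIstr π B).snd := congrArg CFP.Hom.snd h
    have e₁ : (f ≫ toIstr π B).snd = f.snd := Category.comp_id _
    have e₂ : (g ≫ toIstr π B).snd = g.snd := Category.comp_id _
    rw [← e₁, ← e₂, e]
  refine CFP.hom_ext (C0.hom_ext ?_ ?_ ?_) hsnd
  · rw [← hb₁, ← hb₂, h]
  · rw [← hd₁, ← hd₂, h]
  · rw [← hs₁, ← hs₂, h]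

/-- An arrow `f : B → X` into an object with naively isotropic region extends to the hull: `B^istr → X`
with the same data. [cite: MochizukiFrdII2008, Ex 3.3 (ii) p.28] -/
def istrDesc {B X : C π} (f : B ⟶ X) (hX : X.fst.IsNaivelyIsotropic) : istrObj π B ⟶ X where
  fst := C0.homOfNorm (C0.isotropify B.fst) X.fst (show B.fst.base ⟶ X.fst.base from C0.Base f.fst)
    (C0.degFr f.fst) (C0.scalar f.fst) (C0.Hom.scalar_mem f.fst) hX (C0.norm_scalar_mul_tip_pow_le f.fst)
  snd := f.snd
  w := f.w

/-- `B → B^istr → X` is `f`. [cite: MochizukiFrdII2008, Ex 3.3 (ii) p.28] -/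
theorem toIstr_istrDesc {B X : C π} (f : B ⟶ X) (hX : X.fst.IsNaivelyIsotropic) :
    toIstr π B ≫ istrDesc π f hX = f := by
  refine CFP.hom_ext (C0.hom_ext ?_ ?_ ?_) (Category.id_comp _)
  · change 𝟙 _ ≫ C0.Base f.fst = _; exact Category.id_comp _
  · change 1 * C0.degFr f.fst = _; exact one_mul _
  · rw [CFP.comp_fst, C0.scalar_comp']
    change D0.galAct (D0.Hom.twists (𝟙 B.fst.base)) (C0.scalar f.fst) * 1 ^ (C0.degFr f.fst : ℕ) = _
    rw [D0.twists_id, D0.galAct_false, one_pow, mul_one]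

variable (B : C π)

/-- `γ ↦ γ^istr`: the group homomorphism `Aut(B) → Aut(B^istr)` induced by the isotropification functor
`istrEndo`. [cite: MochizukiFrdII2008, Ex 3.3 (ii) p.28] -/
def istrAutHom : Aut B →* Aut (istrObj π B) where
  toFun γ := (istrEndo π).mapIso γ
  map_one' := (istrEndo π).mapIso_refl B
  map_mul' γ δ := (istrEndo π).mapIso_trans δ γ

/-- The underlying arrow of `γ^istr`. [cite: MochizukiFrdII2008, Ex 3.3 (ii) p.28] -/
theorem istrAutHom_hom (γ : Aut B) : (istrAutHom π B γ).hom = istrMap π γ.hom := rfl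

/-- `γ ↦ γ^istr` is injective (the data of `γ` are those of `γ^istr`). [cite: MochizukiFrdII2008, Ex 3.3 (ii) p.28] -/
theorem istrAutHom_injective : Function.Injective (istrAutHom π B) := by
  intro γ δ h
  have h1 : istrMap π γ.hom = istrMap π δ.hom := by
    rw [← istrAutHom_hom, ← istrAutHom_hom, h]
  have hfst := congrArg CFP.Hom.fst h1
  have hsnd' := congrArg CFP.Hom.snd h1
  have hsnd : γ.hom.snd = δ.hom.snd := hsnd'
  have hb := congrArg C0.Hom.base hfst
  have hd := congrArg C0.Hom.degFr hfst
  have hs := congrArg C0.Hom.scalar hfst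
  apply Iso.ext
  exact CFP.hom_ext (C0.hom_ext hb hd hs) hsnd

/-- Compatibility of the action with the hull arrow: `γ ≫ (B → B^istr) = (B → B^istr) ≫ γ^istr`.
[cite: MochizukiFrdII2008, Ex 3.3 (ii) p.28] -/
theorem toIstr_naturality_aut (γ : Aut B) : γ.hom ≫ toIstr π B = toIstr π B ≫ (istrAutHom π B γ).hom := by
  rw [istrAutHom_hom]; exact toIstr_naturality π γ.hom

/-! ### [FrdI] Remark 3.1.1 for `C`: quotients onto isotropic objects have isotropic source -/

/-- **The argument of [FrdI] Rmk. 3.1.1 in `C`**: if `f : B → X` is a mono-minimal categorical quotient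
of `B` by `G ⊆ Aut(B)` and `X` has naively isotropic region, then so does `B` (the hull `B → B^istr` is a
`G`-compatible monomorphism through which `f` factors, hence an isomorphism).
[cite: MochizukiFrdII2008, Prop 3.5 (iv) p.34] -/
theorem isNaivelyIsotropic_of_monoMinimalQuotient {B X : C π} (G : Subgroup (Aut B)) (f : B ⟶ X)
    (hf : IsMonoMinimalQuotient G f) (hX : X.fst.IsNaivelyIsotropic) : B.fst.IsNaivelyIsotropic := by
  haveI : Mono (toIstr π B) := mono_toIstr π B
  haveI : IsIso (toIstr π B) :=
    hf.2 (toIstr π B) (istrDesc π f hX) (toIstr_istrDesc π f hX) inferInstance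
      ⟨G.map (istrAutHom π B), G.equivMapOfInjective _ (istrAutHom_injective π B), fun γ => by
        rw [Subgroup.coe_equivMapOfInjective_apply]; exact toIstr_naturality_aut π B γ⟩
  exact C0.isNaivelyIsotropic_of_hom (inv (toIstr π B)).fst (C0.isNaivelyIsotropic_isotropify B.fst)

/-! ### Proposition 3.5 (iv) for `C` -/

/-- **Proposition 3.5 (iv) for `C = C^ℤ`** (PROVED, for `D` connected and totally epimorphic as in
Example 3.3): `C` is not of RC-iso-subanchor type. If it were, a complex object would exist, hence a
complex isotropic one `X`; an RC-iso-subanchor presentation `B → X` has `B` isotropic ([FrdI] Rmk. 3.1.1),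
the RC-subanchor arrow `B → B″` makes the RC-anchor `B″` isotropic ([FrdI] Def. 1.3 (vii)(b)), and
isotropic objects are not anchors of `C[ℂ]`. [cite: MochizukiFrdII2008, Prop 3.5 (iv) p.34] -/
theorem prop35iv_C (hD : IsGraphConnected D) (hTE : IsTotallyEpimorphic D) : Prop35iv_C π := by
  intro _ hC
  obtain ⟨d₀⟩ := hD.nonempty
  -- a complex object: the RC-anchor above any object
  obtain ⟨_, _, _, ⟨B', ⟨hc', _⟩, _⟩, _⟩ := hC.isRCIsoSubanchor (unitObjOver π d₀)
  -- the complex isotropic object over the base of `B'`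
  obtain ⟨B₂, G₂, f₂, ⟨B₃, ⟨hc₃, hanch₃⟩, ⟨g₂⟩⟩, hf₂⟩ := hC.isRCIsoSubanchor (unitObjOver π B'.snd)
  have hB₂ : B₂.fst.IsNaivelyIsotropic :=
    isNaivelyIsotropic_of_monoMinimalQuotient π G₂ f₂ hf₂ (AngularRegion.isIsotropic_isotropicOfTip 1)
  have hB₃ : B₃.fst.IsNaivelyIsotropic := C0.isNaivelyIsotropic_of_hom g₂.fst hB₂
  exact not_isAnchor_complexPart_of_isotropic π hTE B₃ hc₃ hB₃ hanch₃

end ArchFrd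

end

end Literature.AlgebraicGeometry.Frobenioids
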